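import Summits.RiemannHypothesis.RiemannHypothesis.Theorems.GroundBartaEvenWinsBeyondArchDeflationCrossPanelsRad
import HarnessLib

/-!
# RiemannHypothesis / GroundBarta — rung 4 (`EvenWinsBeyondArch`, stmt-RiemannHypothesis-18807 / 18085):
# R-layer split panels — the vector-independent breakpoint/flag facts PACKAGED once per panel (lever #7, part 2)

Helper file (`--supports stmt-RiemannHypothesis-18085`), RH-free, no facts, standard axioms.

On a y-panel containing a switch point of a prime slot, every per-vector `L²` bound (`dt_panelQL_split4''`) and every
per-pair cross bound (`dt_panelCross4_split''` / `dt_panelCross4_split_rad`) takes the SAME five vector-independent data: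
a breakpoint `β ∈ [b⁻, b⁺]` and the two flag tables valid on `(-h, β)` and `(β, h)` — today re-derived inline (≈ 10 lines of
generated proof text) in every Q file and every X file that meets the panel.  `dt_SplitFacts W j f f' b⁻ b⁺` names that
package; a cell's Shared file proves it ONCE per split panel, and the wrappers `dt_panelQL_split4P`,
`dt_panelCross4_split_radP` consume it, so a split panel costs a certificate file the same few lines as a bulk panel
(the cross layer of a cell then fits one ≤ 400-line file per vector pair).

References: E. Bombieri, Rend. Mat. Acc. Lincei (9) 11 (2000) Thm 2 [Bombieri2000Weil]; R. E. Moore, *Interval Analysis*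
(1966) Thm 3.1 [Moore1966]; Goerisch–Haunhorst (1985) §2 [GoerischHaunhorst1985].
-/

set_option linter.dupNamespace false

noncomputable section

open MeasureTheory Set Filter intervalIntegral
open scoped Topology BigOperators ComplexConjugate

namespace Summit.RiemannHypothesis.RiemannHypothesis.Theorems.EvenWinsBeyondArch

open Literature.NumberTheory.LFunctions
open Literature.Analysis.ValidatedNumerics Literature.Analysis.ValidatedNumerics.PolyMP
  Literature.Analysis.ValidatedNumerics.NumericsMP Literature.Analysis.ValidatedNumerics.ExpPoly

section SplitFacts

variable {S : ℕ} {c : ℚ} {m Dl k : ℕ}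

/-- **Packaged split-panel facts** (vector-independent): a breakpoint `β ∈ [b⁻, b⁺]` of y-panel `j` and the prime-slot
flag tables `f` (valid on `(-h, β)`) and `f'` (valid on `(β, h)`), `h = c/(2m)`. -/
def dt_SplitFacts (W : dt_WinL4 S c m Dl) (j : ℕ) (f1 f2 f3 f4 f1' f2' f3' f4' : Bool × Bool) (bm bp : ℚ) : Prop :=
  ∃ β : ℝ, (bm : ℝ) ≤ β ∧ β ≤ bp ∧
    (∀ ρ : ℝ, -((c / (2 * m) : ℚ) : ℝ) < ρ → ρ < β →
      (f1.1 = true ↔ (((PolyMP.panelCentre (c / (2 * m)) j : ℚ) : ℝ) + ρ) - W.L1 ∈ Icc (-(c : ℝ)) c) ∧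
      (f1.2 = true ↔ (((PolyMP.panelCentre (c / (2 * m)) j : ℚ) : ℝ) + ρ) + W.L1 ∈ Icc (-(c : ℝ)) c) ∧
      (f2.1 = true ↔ (((PolyMP.panelCentre (c / (2 * m)) j : ℚ) : ℝ) + ρ) - W.L2 ∈ Icc (-(c : ℝ)) c) ∧
      (f2.2 = true ↔ (((PolyMP.panelCentre (c / (2 * m)) j : ℚ) : ℝ) + ρ) + W.L2 ∈ Icc (-(c : ℝ)) c) ∧
      (f3.1 = true ↔ (((PolyMP.panelCentre (c / (2 * m)) j : ℚ) : ℝ) + ρ) - W.L3 ∈ Icc (-(c : ℝ)) c) ∧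
      (f3.2 = true ↔ (((PolyMP.panelCentre (c / (2 * m)) j : ℚ) : ℝ) + ρ) + W.L3 ∈ Icc (-(c : ℝ)) c) ∧
      (f4.1 = true ↔ (((PolyMP.panelCentre (c / (2 * m)) j : ℚ) : ℝ) + ρ) - W.L4 ∈ Icc (-(c : ℝ)) c) ∧
      (f4.2 = true ↔ (((PolyMP.panelCentre (c / (2 * m)) j : ℚ) : ℝ) + ρ) + W.L4 ∈ Icc (-(c : ℝ)) c)) ∧
    (∀ ρ : ℝ, β < ρ → ρ < ((c / (2 * m) : ℚ) : ℝ) →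
      (f1'.1 = true ↔ (((PolyMP.panelCentre (c / (2 * m)) j : ℚ) : ℝ) + ρ) - W.L1 ∈ Icc (-(c : ℝ)) c) ∧
      (f1'.2 = true ↔ (((PolyMP.panelCentre (c / (2 * m)) j : ℚ) : ℝ) + ρ) + W.L1 ∈ Icc (-(c : ℝ)) c) ∧
      (f2'.1 = true ↔ (((PolyMP.panelCentre (c / (2 * m)) j : ℚ) : ℝ) + ρ) - W.L2 ∈ Icc (-(c : ℝ)) c) ∧
      (f2'.2 = true ↔ (((PolyMP.panelCentre (c / (2 * m)) j : ℚ) : ℝ) + ρ) + W.L2 ∈ Icc (-(c : ℝ)) c) ∧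
      (f3'.1 = true ↔ (((PolyMP.panelCentre (c / (2 * m)) j : ℚ) : ℝ) + ρ) - W.L3 ∈ Icc (-(c : ℝ)) c) ∧
      (f3'.2 = true ↔ (((PolyMP.panelCentre (c / (2 * m)) j : ℚ) : ℝ) + ρ) + W.L3 ∈ Icc (-(c : ℝ)) c) ∧
      (f4'.1 = true ↔ (((PolyMP.panelCentre (c / (2 * m)) j : ℚ) : ℝ) + ρ) - W.L4 ∈ Icc (-(c : ℝ)) c) ∧
      (f4'.2 = true ↔ (((PolyMP.panelCentre (c / (2 * m)) j : ℚ) : ℝ) + ρ) + W.L4 ∈ Icc (-(c : ℝ)) c))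

/-- **Split panel `L²` bound from the package** (as `dt_panelQL_split4''`). [cite: Bombieri2000Weil, Thm 2] -/
theorem dt_panelQL_split4P (hS : 0 < S) (hc : 0 < c) (W : dt_WinL4 S c m Dl) (hh1 : 2 * (c / (2 * m)) ≤ 1)
    (gp : Fin k → Poly) (Mt : ℚ) (Wt : Fin k → Fin k → ℚ) (i : Fin k) (V : dt_VecL S c m Dl (gp i)) {j : ℕ}
    (hjm : j + 2 ≤ m) {K : ℕ} (hK : 0 < K) {Ke ke : ℕ} {f1 f2 f3 f4 f1' f2' f3' f4' : Bool × Bool} {bm bp : ℚ}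
    (hsf : dt_SplitFacts W j f1 f2 f3 f4 f1' f2' f3' f4' bm bp)
    (hchk : dt_splitCheckL S c m W.M0.length (gp i) j Ke ke bm bp = true)
    (hRi : IntervalIntegrable (fun ρ ↦
      dt_windowResidual4 (c : ℝ) gp W.w1 W.L1 W.w2 W.L2 W.w3 W.L3 W.w4 W.L4 (Mt : ℝ) (fun a l ↦ (Wt a l : ℝ)) i
        (((PolyMP.panelCentre (c / (2 * m)) j : ℚ) : ℝ) + ρ) ^ 2) volume (-((c / (2 * m) : ℚ) : ℝ)) ((c / (2 * m) : ℚ) : ℝ))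
    {Etm F N R : IPoly} (hE : dt_archETM S c m j Dl (dt_locI S (gp i) (ofRat S (PolyMP.panelCentre (c / (2 * m)) j))) W.M0 (ttruncI S (c / (2 * m)) Dl (dt_locI S (gp i) (ofRat S (PolyMP.panelCentre (c / (2 * m)) j)))) V.tabF W.muF (fun i ↦ (W.Dρ.getD i default).1) (fun i ↦ (W.Dρ.getD i default).2) = Etm)
    (hF : dt_archHfoldTM S m j (ttruncI S (c / (2 * m)) Dl (dt_locI S (gp i) (ofRat S (PolyMP.panelCentre (c / (2 * m)) j)))) V.tabF W.muF = F) (hN : dt_archHnearTM S c m j Dl (ttruncI S (c / (2 * m)) Dl (dt_locI S (gp i) (ofRat S (PolyMP.panelCentre (c / (2 * m)) j)))) V.tabF W.muF (fun i ↦ (W.Dρ.getD i default).1) (fun i ↦ (W.Dρ.getD i default).2) = N)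
    (hR : dt_archHfarTM S c m j Dl (ttruncI S (c / (2 * m)) Dl (dt_locI S (gp i) (ofRat S (PolyMP.panelCentre (c / (2 * m)) j)))) V.tabF W.muF (fun i ↦ (W.Dρ.getD i default).1) (fun i ↦ (W.Dρ.getD i default).2) = R) (pA pB : Poly) :
    ∫ ρ in (-((c / (2 * m) : ℚ) : ℝ))..((c / (2 * m) : ℚ) : ℝ),
        dt_windowResidual4 (c : ℝ) gp W.w1 W.L1 W.w2 W.L2 W.w3 W.L3 W.w4 W.L4 (Mt : ℝ) (fun a l ↦ (Wt a l : ℝ)) i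
          (((PolyMP.panelCentre (c / (2 * m)) j : ℚ) : ℝ) + ρ) ^ 2 ≤
      ((sqIntegSubLocQ S (c / (2 * m)) (dt_panelLTM4' S c m Dl K Ke ke W gp Mt Wt i V j f1 f2 f3 f4 Etm (taddI (tsubI F N) R)) pA
          (-(c / (2 * m))) bp : ℚ) : ℝ) +
        ((sqIntegSubLocQ S (c / (2 * m)) (dt_panelLTM4' S c m Dl K Ke ke W gp Mt Wt i V j f1' f2' f3' f4' Etm (taddI (tsubI F N) R)) pB
          bm (c / (2 * m)) : ℚ) : ℝ) := by
  obtain ⟨β, h1, h2, hA, hB⟩ := hsf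
  exact dt_panelQL_split4'' hS hc W hh1 gp Mt Wt i V hjm hK f1 f2 f3 f4 f1' f2' f3' f4' hchk h1 h2 hA hB hRi hE hF hN hR pA pB

/-- **Split panel cross bound, radius form, from the package** (as `dt_panelCross4_split_rad`).
[cite: Bombieri2000Weil, Thm 2] [cite: Moore1966, Theorem 3.1] -/
theorem dt_panelCross4_split_radP (hS : 0 < S) (hc : 0 < c) (W : dt_WinL4 S c m Dl) (hh1 : 2 * (c / (2 * m)) ≤ 1)
    (gp : Fin k → Poly) (Mt : ℚ) (Wt : Fin k → Fin k → ℚ) (i i' : Fin k) (V : dt_VecL S c m Dl (gp i))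
    (V' : dt_VecL S c m Dl (gp i')) {j : ℕ}
    (hjm : j + 2 ≤ m) {K : ℕ} (hK : 0 < K) {Ke ke : ℕ} {f1 f2 f3 f4 f1' f2' f3' f4' : Bool × Bool} {bm bp : ℚ}
    (hsf : dt_SplitFacts W j f1 f2 f3 f4 f1' f2' f3' f4' bm bp)
    (hchk : dt_splitCheckL S c m W.M0.length (gp i) j Ke ke bm bp = true)
    (hchk' : dt_splitCheckL S c m W.M0.length (gp i') j Ke ke bm bp = true)
    {Etm F N R : IPoly}
    (hE : dt_archETM S c m j Dl (dt_locI S (gp i) (ofRat S (PolyMP.panelCentre (c / (2 * m)) j))) W.M0 (ttruncI S (c / (2 * m)) Dl (dt_locI S (gp i) (ofRat S (PolyMP.panelCentre (c / (2 * m)) j)))) V.tabF W.muF (fun i ↦ (W.Dρ.getD i default).1) (fun i ↦ (W.Dρ.getD i default).2) = Etm)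
    (hF : dt_archHfoldTM S m j (ttruncI S (c / (2 * m)) Dl (dt_locI S (gp i) (ofRat S (PolyMP.panelCentre (c / (2 * m)) j)))) V.tabF W.muF = F) (hN : dt_archHnearTM S c m j Dl (ttruncI S (c / (2 * m)) Dl (dt_locI S (gp i) (ofRat S (PolyMP.panelCentre (c / (2 * m)) j)))) V.tabF W.muF (fun i ↦ (W.Dρ.getD i default).1) (fun i ↦ (W.Dρ.getD i default).2) = N)
    (hR : dt_archHfarTM S c m j Dl (ttruncI S (c / (2 * m)) Dl (dt_locI S (gp i) (ofRat S (PolyMP.panelCentre (c / (2 * m)) j)))) V.tabF W.muF (fun i ↦ (W.Dρ.getD i default).1) (fun i ↦ (W.Dρ.getD i default).2) = R)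
    {Etm' F' N' R' : IPoly}
    (hE' : dt_archETM S c m j Dl (dt_locI S (gp i') (ofRat S (PolyMP.panelCentre (c / (2 * m)) j))) W.M0 (ttruncI S (c / (2 * m)) Dl (dt_locI S (gp i') (ofRat S (PolyMP.panelCentre (c / (2 * m)) j)))) V'.tabF W.muF (fun i ↦ (W.Dρ.getD i default).1) (fun i ↦ (W.Dρ.getD i default).2) = Etm')
    (hF' : dt_archHfoldTM S m j (ttruncI S (c / (2 * m)) Dl (dt_locI S (gp i') (ofRat S (PolyMP.panelCentre (c / (2 * m)) j)))) V'.tabF W.muF = F') (hN' : dt_archHnearTM S c m j Dl (ttruncI S (c / (2 * m)) Dl (dt_locI S (gp i') (ofRat S (PolyMP.panelCentre (c / (2 * m)) j)))) V'.tabF W.muF (fun i ↦ (W.Dρ.getD i default).1) (fun i ↦ (W.Dρ.getD i default).2) = N')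
    (hR' : dt_archHfarTM S c m j Dl (ttruncI S (c / (2 * m)) Dl (dt_locI S (gp i') (ofRat S (PolyMP.panelCentre (c / (2 * m)) j)))) V'.tabF W.muF (fun i ↦ (W.Dρ.getD i default).1) (fun i ↦ (W.Dρ.getD i default).2) = R')
    (hfg : IntervalIntegrable (fun ρ ↦
      dt_windowResidual4 (c : ℝ) gp W.w1 W.L1 W.w2 W.L2 W.w3 W.L3 W.w4 W.L4 (Mt : ℝ) (fun a l ↦ (Wt a l : ℝ)) i
        (((PolyMP.panelCentre (c / (2 * m)) j : ℚ) : ℝ) + ρ) *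
      dt_windowResidual4 (c : ℝ) gp W.w1 W.L1 W.w2 W.L2 W.w3 W.L3 W.w4 W.L4 (Mt : ℝ) (fun a l ↦ (Wt a l : ℝ)) i'
        (((PolyMP.panelCentre (c / (2 * m)) j : ℚ) : ℝ) + ρ)) volume (-((c / (2 * m) : ℚ) : ℝ)) ((c / (2 * m) : ℚ) : ℝ))
    (pA pA' pB pB' : Poly) {dA dA' dB dB' : ℚ}
    (hdA : dt_tmRadQ S (c / (2 * m)) (dt_panelLTM4' S c m Dl K Ke ke W gp Mt Wt i V j f1 f2 f3 f4 Etm (taddI (tsubI F N) R)) pA ≤ dA)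
    (hdA' : dt_tmRadQ S (c / (2 * m)) (dt_panelLTM4' S c m Dl K Ke ke W gp Mt Wt i' V' j f1 f2 f3 f4 Etm' (taddI (tsubI F' N') R')) pA' ≤ dA')
    (hdB : dt_tmRadQ S (c / (2 * m)) (dt_panelLTM4' S c m Dl K Ke ke W gp Mt Wt i V j f1' f2' f3' f4' Etm (taddI (tsubI F N) R)) pB ≤ dB)
    (hdB' : dt_tmRadQ S (c / (2 * m)) (dt_panelLTM4' S c m Dl K Ke ke W gp Mt Wt i' V' j f1' f2' f3' f4' Etm' (taddI (tsubI F' N') R')) pB' ≤ dB') :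
    |(∫ ρ in (-((c / (2 * m) : ℚ) : ℝ))..((c / (2 * m) : ℚ) : ℝ),
        dt_windowResidual4 (c : ℝ) gp W.w1 W.L1 W.w2 W.L2 W.w3 W.L3 W.w4 W.L4 (Mt : ℝ) (fun a l ↦ (Wt a l : ℝ)) i
        (((PolyMP.panelCentre (c / (2 * m)) j : ℚ) : ℝ) + ρ) *
        dt_windowResidual4 (c : ℝ) gp W.w1 W.L1 W.w2 W.L2 W.w3 W.L3 W.w4 W.L4 (Mt : ℝ) (fun a l ↦ (Wt a l : ℝ)) i'
        (((PolyMP.panelCentre (c / (2 * m)) j : ℚ) : ℝ) + ρ)) -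
        (((crossCentreQ pA pA' (-(c / (2 * m))) bp : ℚ) : ℝ) + ((crossCentreQ pB pB' bm (c / (2 * m)) : ℚ) : ℝ))| ≤
      ((dt_crossErrRadQ dA dA' pA pA' (-(c / (2 * m))) bp (bp - bm) : ℚ) : ℝ) +
        ((dt_crossErrRadQ dB dB' pB pB' bm (c / (2 * m)) (bp - bm) : ℚ) : ℝ) := by
  obtain ⟨β, h1, h2, hA, hB⟩ := hsf
  exact dt_panelCross4_split_rad hS hc W hh1 gp Mt Wt i i' V V' hjm hK f1 f2 f3 f4 f1' f2' f3' f4' hchk hchk' h1 h2 hA hB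
    hE hF hN hR hE' hF' hN' hR' hfg pA pA' pB pB' hdA hdA' hdB hdB'

/-- From `|I − C| ≤ E` and the decided `lo ≤ C − E ∧ C + E ≤ hi` (all rationals but `I`): `lo ≤ I ≤ hi`
(the three-line tail of every generated bulk-panel cross theorem, once). -/
theorem dt_lohi_of_absQ {I : ℝ} {C E lo hi : ℚ} (h : |I - ((C : ℚ) : ℝ)| ≤ ((E : ℚ) : ℝ))
    (d : lo ≤ C - E ∧ C + E ≤ hi) : ((lo : ℚ) : ℝ) ≤ I ∧ I ≤ ((hi : ℚ) : ℝ) := by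
  have d1 := (Rat.cast_le (K := ℝ)).2 d.1
  have d2 := (Rat.cast_le (K := ℝ)).2 d.2
  push_cast at d1 d2
  constructor <;> linarith [(abs_le.1 h).1, (abs_le.1 h).2]

/-- Split-panel version: `|I − (cA + cB)| ≤ eA + eB` and the decided
`lo + eB − cB ≤ cA − eA ∧ cA + eA ≤ hi − eB − cB` give `lo ≤ I ≤ hi`. -/
theorem dt_lohi_of_abs_splitQ {I : ℝ} {cA cB eA eB lo hi : ℚ}
    (h : |I - (((cA : ℚ) : ℝ) + ((cB : ℚ) : ℝ))| ≤ ((eA : ℚ) : ℝ) + ((eB : ℚ) : ℝ))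
    (d : lo + eB - cB ≤ cA - eA ∧ cA + eA ≤ hi - eB - cB) : ((lo : ℚ) : ℝ) ≤ I ∧ I ≤ ((hi : ℚ) : ℝ) := by
  have d1 := (Rat.cast_le (K := ℝ)).2 d.1
  have d2 := (Rat.cast_le (K := ℝ)).2 d.2
  push_cast at d1 d2
  constructor <;> linarith [(abs_le.1 h).1, (abs_le.1 h).2]

end SplitFacts

end Summit.RiemannHypothesis.RiemannHypothesis.Theorems.EvenWinsBeyondArch
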